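import Summits.QuantumFields.YangMills.Theorems.UnitScaleTiltProp7GaugeFixedRowDoorOfLODTarget
import HarnessLib

/-!
# Route `UnitScaleTilt`, crux K1 «MinimiserStabilityRegPr» (stmt-QuantumFields-19200), EX face after S45 — **THE `h349` DOOR OF THE LOD LINE: THE KERNEL ROW OF PRINT'S
# `D_{U₀}(1 − R(U₀))D*_{U₀}` ((3.49) p.399) FOLLOWS, ON THE LIFT LOCUS, FROM THE SAME KERNEL ROW STATED WITH THE LOD PROJECTOR `projR Δ_{U₀} Q″` FOR EVERY TOP NESTED MEAN
# `Q″` OF RECORD** — the twin, for the EX row `h349`, of ★p1 g24's γ-row door ✓`Prop7GaugeFixedRowDoorOfLODTarget.gaugeFixedRow_idx_of_curvedTarget_of_le_coupling` (★p1 g25 CHAIR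
# WORD №7; lead seat `ym-ust-19200-p1` gen 25)

Cell `ym3-torus` (HUMAN RULING D-0037; rung R3 = SU(2) YM₃ on T³ — NOT d = 4, NOT infinite volume, NOT a mass gap, NOT Clay).
THEOREMS ONLY (0 `def`, 0 `sorry`); `--supports stmt-QuantumFields-19200 --as helper`; count-neutral.

WHY.  The EX row `h349` of the S44ᴸγ display (✓`UnitScaleTiltMinimiserStabilityRegPrOfEXRowsS44LG.minimiserStabilityRegPr_of_EXrowsS44LG`) is print's kernel bound (3.49) for
`D_{U₀}(1 − R_S(U₀))D*_{U₀}` between two bond spikes, with the intrinsic gauge projector `R_S(U₀)` (✓`Prop7SectET3GaugeProjector.RS`) and the parallel-lift antecedent of record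
(LIFT-THREAD 2).  The (L3′b) storey proves kernel rows for the LOD projector `P = 1 − projR Δ_{U₀} Q″` (V5∕V5b ✓p762771∕✓p762991 VALUE, V6 ✓p763095 `D P D*` from the gradient-column
letter), for ANY top nested mean `Q″` with the averaging clause `htop` and `ker Q″ ≤ N_S(U₀)`.  ON THE LIFT LOCUS the two projectors coincide for the `Q″` OF RECORD
(✓`Prop7LiftOfRSEqPrintProjector.RS_eq_projR_iff_lift` with ✓`Prop7NSIntertwinerOfRecord.exists_intertwiner_of_regPr`, clauses (iii),(v)) — exactly the mechanism of the γ-row door.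
So THIS file fixes the (L3′b) knitters' TARGET BY NAME: prove `hK349` (below) and `h349` follows VERBATIM.
WHAT IS PROVED (ns `Summit.QuantumFields.YangMills.Theorems.Prop7KernelRow349DoorOfLODTarget`).
* §1 ★ `kernelRow349_of_projRTarget` (member): `RegPr F n K ε₀ U₀`, `10¹²L³ε₀ ≤ 1`, the projR-kernel row for every `Q″` of record ⟹ the `R_S`-kernel row on the Lift locus (same constants);
  ★ `kernelRow349_of_projRTarget_of_le` — the same assumed once at a cap `ε₁ ≥ ε₀` (lit ✓`regPr_mono`).
* §2 ★★★ `kernelRow349_idx_of_projRTarget` — AT THE DISPLAY'S INDEX: from `hK349` (the projR-kernel row at the cap `RegPr (αcap L) U₀`, every member `i : Idx L`, every `Q″` of record,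
  constants `C349 L · ((L:ℝ)^(K−n))⁻¹ ^ 3 · e^{−δ349 L · tdist(B b.src, B bd.src)}`) and the window `10¹²L³·αcap L ≤ 1`, the `h349` binder of S44ᴸγ VERBATIM.
HYP-SAT (★★OWNER RULING №42): `hK349` is a real-inequality schema over the literal T³ members (no `Prop` placeholder); it is the (L3′b) storey's target — inhabited, once (G1-3)
lands, by V6 ✓`Prop7ComplementaryProjectorGradientKernel.norm_equiv_DL2_sub_projR_DstarL2_single_le` + the `toL2⁻¹`∕`bondEquiv` readback + `c₁ = c_B = c₀ℓ³` (so `c₀∕c₁ = ((L:ℝ)^(K−n))⁻¹ ^ 3`)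
+ the K-free letter arithmetic of ✓`Prop7LODTargetClosed`'s kind; at fixed `(F,n,K)` it is trivially inhabited by a large `C349 L`-free choice? — NO: `C349` is uniform in the member, which
is the content.  The Lift antecedent and `ρ ≤ αcap L` are the display's own; `hWα` is the window of ✓`gaugeFixedRow_idx_of_curvedTarget_of_le_coupling` (same letter `αcap`).
HONEST SCOPE.  Pure logic over landed doors (two `obtain`s, one `rw`); CONDITIONAL on `hK349`; nothing of `h349`, the ten EX rows, `hT`, `hGF`, EX `stub_existenceMinimalOrbit` or the crux
is proved here; the Yang–Mills mass gap is NOT proved.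

References: T. Bałaban, CMP **99** (1985) 389–434 [Balaban1985BackgroundPropagators] ((3.20)–(3.23) p.394, Thm 3.1 (3.42) p.397, (3.49) p.399, (3.114)–(3.115) p.418).
-/

set_option autoImplicit false

noncomputable section

open scoped InnerProductSpace ComplexConjugate Matrix.Norms.L2Operator BigOperators


open Literature.MathematicalPhysics.QuantumFieldTheory.Balaban1983to89
open Literature.MathematicalPhysics.QuantumFieldTheory.Balaban1983to89.T3ContinuumYM3Torus
open T4Continuum BlockAveraging
open BlockAveraging (Idx)
open B7Prop1Explicit (disp)
open B10Eq27TorusAxialLog (holT transl)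
open B7TransferAnalyticMean (meanCLM)
open B11Eq103H1Complex (SiteL2K BondL2K projR)
open B15DeterminingSets (embIter)
open Summit.QuantumFields.YangMills.Theorems.Prop8Chart (emlIterU)
open T3PrintedRegularMinimiser (RegPr)
open T3PrintedMinimiserExistence (regPr_mono)
open T3SectALandauChart (bgUnits)
open Summit.QuantumFields.YangMills.Theorems.Prop7SectET3Transport (periodsT3)
open Summit.QuantumFields.YangMills.Theorems.Prop7SectET3HilbertLetters (W₂ toL2S DL2 DstarL2 covLapSite)
open Summit.QuantumFields.YangMills.Theorems.Prop7SectET3GaugeProjector (NS RS)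
open Summit.QuantumFields.YangMills.Theorems.Prop7SectET3WilsonHessian (DeltaEta)
open Summit.QuantumFields.YangMills.Theorems.Prop7SectET3CurvedPropagators (Qk)
open Summit.QuantumFields.YangMills.Theorems.Prop7LiftOfRSEqPrintProjector (RS_eq_projR_iff_lift)
open Summit.QuantumFields.YangMills.Theorems.Prop7NSIntertwinerOfRecord (exists_intertwiner_of_regPr)

open B5Eq118OneStroke (iterBlockOf)
open Summit.QuantumFields.YangMills.Theorems.Prop7SectET3HilbertLetters (toL2 DL2)
open B11Eq103H1Complex (projR)

namespace Summit.QuantumFields.YangMills.Theorems.Prop7KernelRow349DoorOfLODTarget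

variable {F : T3Family} {n K : ℕ} (h : n ≤ K) {c₀ : ℝ} [Fact (0 < c₀)] (cB : ℝ)

/-! ## §1 The door at one member -/

/-- ★ **THE KERNEL-ROW DOOR AT A MEMBER.**  At a printed-regular background (`RegPr F n K ε₀ U₀`, `0 < ε₀`, `10¹²L³ε₀ ≤ 1`): if the kernel row of `D_{U₀}(1 − projR Δ_{U₀} Q″)D*_{U₀}`
between bond spikes holds for every top nested mean `Q″` of record (clauses (iii) `htop`, (v) `hker`), with constants `C, δ`, then ON THE LIFT LOCUS the same row holds for print's
intrinsic `R_S(U₀)`: `‖(toL2⁻¹(D_{U₀}(D*_{U₀}δ_bZ − R_S(U₀)D*_{U₀}δ_bZ)))(bd)‖ ≤ C·e^{−δ·tdist(B b.src, B bd.src)}·‖Z‖`.  PROOF: the `Q″` of record (✓`exists_intertwiner_of_regPr`) and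
`R_S(U₀) = projR Δ_{U₀} Q″` on the Lift locus (✓`RS_eq_projR_iff_lift`). [cite: Balaban1985BackgroundPropagators, (3.20)–(3.23) p.394, (3.49) p.399, (3.114)–(3.115) p.418] -/
theorem kernelRow349_of_projRTarget {ε₀ : ℝ} (hε₀ : 0 < ε₀) (hWε : 10 ^ 12 * (F.L : ℝ) ^ 3 * ε₀ ≤ 1)
    (U₀ : GaugeField (F.P K) 0 (Matrix.specialUnitaryGroup (Fin 2) ℂ)) (hreg : RegPr F n K ε₀ U₀) {C δ : ℝ}
    (hK : ∀ (Q'' : SiteL2K ℂ 3 (periodsT3 F K) c₀ W₂ →ₗ[ℂ] (Site (F.P K) (K - n) → Matrix (Fin 2) (Fin 2) ℂ)),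
      (∀ (lam : Site (F.P K) 0 → Matrix (Fin 2) (Fin 2) ℂ) (ns : (j : ℕ) → Site (F.P K) j → Matrix (Fin 2) (Fin 2) ℂ), ns 0 = lam →
        (∀ (j : ℕ) (y : Site (F.P K) (j + 1)), ns (j + 1) y = ns j (emb y) - meanCLM (Idx (F.P K)) (Matrix (Fin 2) (Fin 2) ℂ) fun i : Idx (F.P K) =>
          ns j (emb y) - ((holT (emlIterU j (bgUnits F K U₀)) (emb y) (stairWord i.2.1 (off i.1)) : (Matrix (Fin 2) (Fin 2) ℂ)ˣ) : Matrix (Fin 2) (Fin 2) ℂ) *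
            ns j (transl (emb y) (disp (stairWord i.2.1 (off i.1)))) * (((holT (emlIterU j (bgUnits F K U₀)) (emb y) (stairWord i.2.1 (off i.1)))⁻¹ : (Matrix (Fin 2) (Fin 2) ℂ)ˣ) : Matrix (Fin 2) (Fin 2) ℂ)) →
        ns (K - n) = Q'' (toL2S F K c₀ lam)) →
      LinearMap.ker Q'' ≤ NS F n K h c₀ cB U₀ →
      ∀ (b : PBond (F.P K) 0) (Z : Matrix (Fin 2) (Fin 2) ℂ) (bd : PBond (F.P K) 0),
        ‖(toL2 F K c₀).symm (DL2 F n K c₀ U₀ (DstarL2 F n K c₀ U₀ (toL2 F K c₀ (Pi.single b Z)) - projR (covLapSite F n K c₀ U₀) Q'' (DstarL2 F n K c₀ U₀ (toL2 F K c₀ (Pi.single b Z))))) bd‖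
          ≤ C * Real.exp (-(δ * (Site.tdist (iterBlockOf (K - n) b.src) (iterBlockOf (K - n) bd.src) : ℝ))) * ‖Z‖)
    (hlift : ∀ cf : Site (F.P K) (K - n) → Matrix (Fin 2) (Fin 2) ℂ,
        (∀ e : PBond (F.P K) (K - n), cf e.src = ((emlIterU (K - n) (bgUnits F K U₀) e : (Matrix (Fin 2) (Fin 2) ℂ)ˣ) : Matrix (Fin 2) (Fin 2) ℂ) * cf e.tgt *
          (((emlIterU (K - n) (bgUnits F K U₀) e)⁻¹ : (Matrix (Fin 2) (Fin 2) ℂ)ˣ) : Matrix (Fin 2) (Fin 2) ℂ)) →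
        ∃ l₀ : Site (F.P K) 0 → Matrix (Fin 2) (Fin 2) ℂ,
          (∀ b : PBond (F.P K) 0, l₀ b.src = ((bgUnits F K U₀ b : (Matrix (Fin 2) (Fin 2) ℂ)ˣ) : Matrix (Fin 2) (Fin 2) ℂ) * l₀ b.tgt * (((bgUnits F K U₀ b)⁻¹ : (Matrix (Fin 2) (Fin 2) ℂ)ˣ) : Matrix (Fin 2) (Fin 2) ℂ)) ∧
          ∀ y : Site (F.P K) (K - n), l₀ (embIter (K - n) y) = cf y)
    (b : PBond (F.P K) 0) (Z : Matrix (Fin 2) (Fin 2) ℂ) (bd : PBond (F.P K) 0) :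
    ‖(toL2 F K c₀).symm (DL2 F n K c₀ U₀ (DstarL2 F n K c₀ U₀ (toL2 F K c₀ (Pi.single b Z)) - RS F n K h c₀ cB U₀ (DstarL2 F n K c₀ U₀ (toL2 F K c₀ (Pi.single b Z))))) bd‖
      ≤ C * Real.exp (-(δ * (Site.tdist (iterBlockOf (K - n) b.src) (iterBlockOf (K - n) bd.src) : ℝ))) * ‖Z‖ := by
  obtain ⟨Q'', _D', _hint, _hD', htop, _hseq, hker⟩ := exists_intertwiner_of_regPr (F := F) (c₀ := c₀) h cB hε₀ hWε U₀ hreg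
  rw [(RS_eq_projR_iff_lift (F := F) h cB hε₀ hWε U₀ hreg Q'' htop hker).2 hlift]
  exact hK Q'' htop hker b Z bd

/-- ★ **THE DOOR AT THE CAP**: the projR-kernel row assumed ONCE at a larger regularity parameter `ε₁` (`ε₀ ≤ ε₁`, `10¹²L³ε₁ ≤ 1`) serves every `RegPr ε₀ U₀` with `0 < ε₀ ≤ ε₁`
(lit ✓`T3PrintedMinimiserExistence.regPr_mono`). [cite: Balaban1985BackgroundPropagators, (3.1)–(3.2) p.390, (3.49) p.399] -/
theorem kernelRow349_of_projRTarget_of_le {ε₀ ε₁ : ℝ} (hε₀ : 0 < ε₀) (hε : ε₀ ≤ ε₁) (hWε : 10 ^ 12 * (F.L : ℝ) ^ 3 * ε₁ ≤ 1)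
    (U₀ : GaugeField (F.P K) 0 (Matrix.specialUnitaryGroup (Fin 2) ℂ)) (hreg : RegPr F n K ε₀ U₀) {C δ : ℝ}
    (hK : ∀ (Q'' : SiteL2K ℂ 3 (periodsT3 F K) c₀ W₂ →ₗ[ℂ] (Site (F.P K) (K - n) → Matrix (Fin 2) (Fin 2) ℂ)),
      (∀ (lam : Site (F.P K) 0 → Matrix (Fin 2) (Fin 2) ℂ) (ns : (j : ℕ) → Site (F.P K) j → Matrix (Fin 2) (Fin 2) ℂ), ns 0 = lam →
        (∀ (j : ℕ) (y : Site (F.P K) (j + 1)), ns (j + 1) y = ns j (emb y) - meanCLM (Idx (F.P K)) (Matrix (Fin 2) (Fin 2) ℂ) fun i : Idx (F.P K) =>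
          ns j (emb y) - ((holT (emlIterU j (bgUnits F K U₀)) (emb y) (stairWord i.2.1 (off i.1)) : (Matrix (Fin 2) (Fin 2) ℂ)ˣ) : Matrix (Fin 2) (Fin 2) ℂ) *
            ns j (transl (emb y) (disp (stairWord i.2.1 (off i.1)))) * (((holT (emlIterU j (bgUnits F K U₀)) (emb y) (stairWord i.2.1 (off i.1)))⁻¹ : (Matrix (Fin 2) (Fin 2) ℂ)ˣ) : Matrix (Fin 2) (Fin 2) ℂ)) →
        ns (K - n) = Q'' (toL2S F K c₀ lam)) →
      LinearMap.ker Q'' ≤ NS F n K h c₀ cB U₀ →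
      ∀ (b : PBond (F.P K) 0) (Z : Matrix (Fin 2) (Fin 2) ℂ) (bd : PBond (F.P K) 0),
        ‖(toL2 F K c₀).symm (DL2 F n K c₀ U₀ (DstarL2 F n K c₀ U₀ (toL2 F K c₀ (Pi.single b Z)) - projR (covLapSite F n K c₀ U₀) Q'' (DstarL2 F n K c₀ U₀ (toL2 F K c₀ (Pi.single b Z))))) bd‖
          ≤ C * Real.exp (-(δ * (Site.tdist (iterBlockOf (K - n) b.src) (iterBlockOf (K - n) bd.src) : ℝ))) * ‖Z‖)
    (hlift : ∀ cf : Site (F.P K) (K - n) → Matrix (Fin 2) (Fin 2) ℂ,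
        (∀ e : PBond (F.P K) (K - n), cf e.src = ((emlIterU (K - n) (bgUnits F K U₀) e : (Matrix (Fin 2) (Fin 2) ℂ)ˣ) : Matrix (Fin 2) (Fin 2) ℂ) * cf e.tgt *
          (((emlIterU (K - n) (bgUnits F K U₀) e)⁻¹ : (Matrix (Fin 2) (Fin 2) ℂ)ˣ) : Matrix (Fin 2) (Fin 2) ℂ)) →
        ∃ l₀ : Site (F.P K) 0 → Matrix (Fin 2) (Fin 2) ℂ,
          (∀ b : PBond (F.P K) 0, l₀ b.src = ((bgUnits F K U₀ b : (Matrix (Fin 2) (Fin 2) ℂ)ˣ) : Matrix (Fin 2) (Fin 2) ℂ) * l₀ b.tgt * (((bgUnits F K U₀ b)⁻¹ : (Matrix (Fin 2) (Fin 2) ℂ)ˣ) : Matrix (Fin 2) (Fin 2) ℂ)) ∧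
          ∀ y : Site (F.P K) (K - n), l₀ (embIter (K - n) y) = cf y)
    (b : PBond (F.P K) 0) (Z : Matrix (Fin 2) (Fin 2) ℂ) (bd : PBond (F.P K) 0) :
    ‖(toL2 F K c₀).symm (DL2 F n K c₀ U₀ (DstarL2 F n K c₀ U₀ (toL2 F K c₀ (Pi.single b Z)) - RS F n K h c₀ cB U₀ (DstarL2 F n K c₀ U₀ (toL2 F K c₀ (Pi.single b Z))))) bd‖
      ≤ C * Real.exp (-(δ * (Site.tdist (iterBlockOf (K - n) b.src) (iterBlockOf (K - n) bd.src) : ℝ))) * ‖Z‖ :=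
  kernelRow349_of_projRTarget h cB (lt_of_lt_of_le hε₀ hε) hWε U₀ (regPr_mono (F := F) hε hreg) hK hlift b Z bd

/-! ## §2 The door at the display's index: the `h349` binder of S44ᴸγ VERBATIM -/

/-- ★★★ **THE `h349` DOOR AT THE DISPLAY'S INDEX — conclusion = the `h349` binder text of ✓`UnitScaleTiltMinimiserStabilityRegPrOfEXRowsS44LG.minimiserStabilityRegPr_of_EXrowsS44LG`
VERBATIM** (letters `αcap c₀ cB C349 δ349`, index `i : T3Thm1Carrier.Idx L` = `(F, n, K)` with `F.L = L`, `n < K`): if the (L3′b) storey proves the projR-kernel row `hK349` at the cap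
`RegPr (αcap L) U₀` for every member and every top nested mean of record — constants `C349 L·((L:ℝ)^(K−n))⁻¹ ^ 3`, rate `δ349 L` in the coarse distance of the bond sources' blocks —
and the cap obeys `10¹²L³·αcap L ≤ 1`, then `h349` holds as displayed (every `ρ ≤ αcap L`, on the Lift locus). [cite: Balaban1985BackgroundPropagators, (3.49) p.399, (3.20)–(3.23) p.394] -/
theorem kernelRow349_idx_of_projRTarget (αcap : ℕ → ℝ) (hαcap : ∀ L : ℕ, 1 < L → 0 < αcap L)
    (hWα : ∀ L : ℕ, 1 < L → 10 ^ 12 * (L : ℝ) ^ 3 * αcap L ≤ 1)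
    (c₀ cB : ℕ → ℝ) [hc₀ : ∀ L : ℕ, Fact (0 < c₀ L)] (C349 δ349 : ℕ → ℝ)
    (hK349 : ∀ (L : ℕ), 1 < L → ∀ (i : T3Thm1Carrier.Idx L) (U₀ : GaugeField (i.1.1.P i.1.2.2) 0 (Matrix.specialUnitaryGroup (Fin 2) ℂ)), RegPr i.1.1 i.1.2.1 i.1.2.2 (αcap L) U₀ →
      ∀ (Q'' : SiteL2K ℂ 3 (periodsT3 i.1.1 i.1.2.2) (c₀ L) W₂ →ₗ[ℂ] (Site (i.1.1.P i.1.2.2) (i.1.2.2 - i.1.2.1) → Matrix (Fin 2) (Fin 2) ℂ)),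
        (∀ (lam : Site (i.1.1.P i.1.2.2) 0 → Matrix (Fin 2) (Fin 2) ℂ) (ns : (j : ℕ) → Site (i.1.1.P i.1.2.2) j → Matrix (Fin 2) (Fin 2) ℂ), ns 0 = lam →
          (∀ (j : ℕ) (y : Site (i.1.1.P i.1.2.2) (j + 1)), ns (j + 1) y = ns j (emb y) - meanCLM (Idx (i.1.1.P i.1.2.2)) (Matrix (Fin 2) (Fin 2) ℂ) fun ι : Idx (i.1.1.P i.1.2.2) =>
            ns j (emb y) - ((holT (emlIterU j (bgUnits i.1.1 i.1.2.2 U₀)) (emb y) (stairWord ι.2.1 (off ι.1)) : (Matrix (Fin 2) (Fin 2) ℂ)ˣ) : Matrix (Fin 2) (Fin 2) ℂ) *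
              ns j (transl (emb y) (disp (stairWord ι.2.1 (off ι.1)))) * (((holT (emlIterU j (bgUnits i.1.1 i.1.2.2 U₀)) (emb y) (stairWord ι.2.1 (off ι.1)))⁻¹ : (Matrix (Fin 2) (Fin 2) ℂ)ˣ) : Matrix (Fin 2) (Fin 2) ℂ)) →
          ns (i.1.2.2 - i.1.2.1) = Q'' (toL2S i.1.1 i.1.2.2 (c₀ L) lam)) →
        LinearMap.ker Q'' ≤ NS i.1.1 i.1.2.1 i.1.2.2 i.2.2.le (c₀ L) (cB L) U₀ →
      ∀ (b : PBond (i.1.1.P i.1.2.2) 0) (Z : Matrix (Fin 2) (Fin 2) ℂ) (bd : PBond (i.1.1.P i.1.2.2) 0),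
        ‖(toL2 i.1.1 i.1.2.2 (c₀ L)).symm (DL2 i.1.1 i.1.2.1 i.1.2.2 (c₀ L) U₀ (DstarL2 i.1.1 i.1.2.1 i.1.2.2 (c₀ L) U₀ (toL2 i.1.1 i.1.2.2 (c₀ L) (Pi.single b Z)) - projR (covLapSite i.1.1 i.1.2.1 i.1.2.2 (c₀ L) U₀) Q'' (DstarL2 i.1.1 i.1.2.1 i.1.2.2 (c₀ L) U₀ (toL2 i.1.1 i.1.2.2 (c₀ L) (Pi.single b Z))))) bd‖
          ≤ C349 L * ((L : ℝ) ^ (i.1.2.2 - i.1.2.1))⁻¹ ^ 3 * Real.exp (-(δ349 L * (Site.tdist (iterBlockOf (i.1.2.2 - i.1.2.1) b.src) (iterBlockOf (i.1.2.2 - i.1.2.1) bd.src) : ℝ))) * ‖Z‖) :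
    ∀ (L : ℕ), 1 < L → ∀ (i : T3Thm1Carrier.Idx L) (U₀ : GaugeField (i.1.1.P i.1.2.2) 0 (Matrix.specialUnitaryGroup (Fin 2) ℂ)), ∀ ρ : ℝ, RegPr i.1.1 i.1.2.1 i.1.2.2 ρ U₀ → ρ ≤ αcap L →
        -- LIFT-THREAD 2: the `Lift L i U₀` antecedent of record (w2 g6; discharged at the junction by ✓`hIrrLift_of_record`)
        (∀ cf : Site (i.1.1.P i.1.2.2) (i.1.2.2 - i.1.2.1) → Matrix (Fin 2) (Fin 2) ℂ,
        (∀ e' : PBond (i.1.1.P i.1.2.2) (i.1.2.2 - i.1.2.1), cf e'.src = ((emlIterU (i.1.2.2 - i.1.2.1) (bgUnits i.1.1 i.1.2.2 U₀) e' : (Matrix (Fin 2) (Fin 2) ℂ)ˣ) : Matrix (Fin 2) (Fin 2) ℂ) * cf e'.tgt *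
        (((emlIterU (i.1.2.2 - i.1.2.1) (bgUnits i.1.1 i.1.2.2 U₀) e')⁻¹ : (Matrix (Fin 2) (Fin 2) ℂ)ˣ) : Matrix (Fin 2) (Fin 2) ℂ)) →
        ∃ l₀ : Site (i.1.1.P i.1.2.2) 0 → Matrix (Fin 2) (Fin 2) ℂ,
        (∀ b' : PBond (i.1.1.P i.1.2.2) 0, l₀ b'.src = ((bgUnits i.1.1 i.1.2.2 U₀ b' : (Matrix (Fin 2) (Fin 2) ℂ)ˣ) : Matrix (Fin 2) (Fin 2) ℂ) * l₀ b'.tgt * (((bgUnits i.1.1 i.1.2.2 U₀ b')⁻¹ : (Matrix (Fin 2) (Fin 2) ℂ)ˣ) : Matrix (Fin 2) (Fin 2) ℂ)) ∧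
        ∀ y : Site (i.1.1.P i.1.2.2) (i.1.2.2 - i.1.2.1), l₀ (embIter (i.1.2.2 - i.1.2.1) y) = cf y) →
      ∀ (b : PBond (i.1.1.P i.1.2.2) 0) (Z : Matrix (Fin 2) (Fin 2) ℂ) (bd : PBond (i.1.1.P i.1.2.2) 0),
        ‖(toL2 i.1.1 i.1.2.2 (c₀ L)).symm (DL2 i.1.1 i.1.2.1 i.1.2.2 (c₀ L) U₀ (DstarL2 i.1.1 i.1.2.1 i.1.2.2 (c₀ L) U₀ (toL2 i.1.1 i.1.2.2 (c₀ L) (Pi.single b Z)) - RS i.1.1 i.1.2.1 i.1.2.2 i.2.2.le (c₀ L) (cB L) U₀ (DstarL2 i.1.1 i.1.2.1 i.1.2.2 (c₀ L) U₀ (toL2 i.1.1 i.1.2.2 (c₀ L) (Pi.single b Z))))) bd‖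
          ≤ C349 L * ((L : ℝ) ^ (i.1.2.2 - i.1.2.1))⁻¹ ^ 3 * Real.exp (-(δ349 L * (Site.tdist (iterBlockOf (i.1.2.2 - i.1.2.1) b.src) (iterBlockOf (i.1.2.2 - i.1.2.1) bd.src) : ℝ))) * ‖Z‖ := by
  intro L hL i U₀ ρ hreg hρ hlift b Z bd
  have hFL : (i.1.1.L : ℝ) = (L : ℝ) := by rw [i.2.1]
  have hWε : 10 ^ 12 * (i.1.1.L : ℝ) ^ 3 * αcap L ≤ 1 := by rw [hFL]; exact hWα L hL
  exact kernelRow349_of_projRTarget (F := i.1.1) (n := i.1.2.1) (K := i.1.2.2) (c₀ := c₀ L) i.2.2.le (cB L) (hαcap L hL) hWε U₀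
    (regPr_mono (F := i.1.1) hρ hreg) (hK349 L hL i U₀ (regPr_mono (F := i.1.1) hρ hreg)) hlift b Z bd

end Summit.QuantumFields.YangMills.Theorems.Prop7KernelRow349DoorOfLODTarget

end
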